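import Summits.BirchSwinnertonDyer.BirchSwinnertonDyer.Theorems.KimAtThreeDeepLowerOffStratumLevelLoweringMultiStabRows
import Literature.NumberTheory.EllipticCurves.LevelLoweringGamma0AtThreeSquarefree
import Literature.NumberTheory.EllipticCurves.LFunctionPrimeCoeffMultiplicative
import HarnessLib

/-!
# Route `KimAtThreeKolyvagin` (rung W2), crux `DeepLowerAtThreeOffKatoStratum` (item 19679), registered
# stub `stub_nonAdditive`: ALL SEMISTABLE depth-`1` rows, from THIRTEEN NAMED FACTS and the row conditions only
# (ROAD (b^k) CLOSED by name)

Cell `bsd-addord`, seat `bsd-addord-w2-acc2`, gen 6; item `stmt-BirchSwinnertonDyer-19679` (`--supports`, closes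
nothing). ONE application of ★⁵ `…MultiStabRows.stub_nonAdditive_semistable_squarefree_of_exists_levelLoweredNewform`
to the general-form level-lowering fact `ribet1990_levelLowering_gamma0_newform_at_three_squarefree` (module
`Literature.NumberTheory.EllipticCurves.LevelLoweringGamma0AtThreeSquarefree`, BY NAME) at the removed set `D·q`; the
signs `a_p(f) = ±1` at the primes of `D` are read off `Semistable W₀` (`LFunctionPrimeCoeffMultiplicative`).

★⁵′ `stub_nonAdditive_semistable_squarefree` — the registered stub's binders VERBATIM (level `N`) + `Semistable W₀` +
«ordinary if good at `3`» + `v₃(∏ c_ℓ) ≤ 1` + `M₀·D·q = N`, `q` split multiplicative, `q ∤ M₀D`, `M₀D` squarefree,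
`3 ∣ ord_q Δ`, `3 ∣ ord_r Δ` (`r ∣ D` prime), `3 ∤ ord_p Δ` (`p ∣ M₀` prime, `p ≠ 3`), `3 ∣ M₀ → 3 ∤ ord_3 Δ` ⟹ the
LOWER deep inequality of 19679. This subsumes gen 5's ★★★′ (`D = 1`, 20 678 rows) and ★★★★′ (`D` prime, 8 107 rows)
and adds the 871 rows with `≥ 2` extra unramified primes: all 29 656 semistable depth-`1` rows of the planner's census
from named print. Theorems only; nothing booked; BSD is not proved by any of this.
-/

set_option autoImplicit false
-- the Theorems namespace of a single-conjunct summit repeats the summit name by design (D-0017)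
set_option linter.dupNamespace false

noncomputable section

open scoped MatrixGroups ModularForm Classical NNReal

open CongruenceSubgroup WeierstrassCurve Literature.NumberTheory.EllipticCurves
  Literature.NumberTheory.EllipticCurves.ModularForms

namespace Summit.BirchSwinnertonDyer.BirchSwinnertonDyer.Theorems.KimAtThreeDeepLowerOffStratumLevelLoweringMultiStabRowsFinal

open Summit.BirchSwinnertonDyer.BirchSwinnertonDyer.Theorems.KimAtThreeDeepLowerOffStratumLevelLoweringMultiStabRows
open Literature.NumberTheory.EllipticCurves.Rank1Residual Literature.NumberTheory.EllipticCurves.Rank1Residual.Typed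
  Literature.NumberTheory.EllipticCurves.Skinner2016 Literature.NumberTheory.Automorphic

/-- ★⁵′ **`stub_nonAdditive` (crux 19679 `DeepLowerAtThreeOffKatoStratum`) on ALL its SEMISTABLE depth-`1` rows, from
THIRTEEN NAMED FACTS and the ROW CONDITIONS ONLY.** One application of
`stub_nonAdditive_semistable_squarefree_of_exists_levelLoweredNewform` (ROAD (b^k): `k`-fold stabilisation of the
optimal-level newform) to the general-form level-lowering fact BY NAME; the signs `a_p(f_E) = ±1` at the primes of `D`
come from `Semistable W₀` (multiplicative reduction at every bad prime).
[cite: Edixhoven1997, Thm. 3.1] [cite: DarmonDiamondTaylor1995, Thm. 3.15 and Prop. 2.12]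
[cite: Diamond1995RefinedSerre, Thm. 6.4 and Cor. 6.5] [cite: Ribet1990, Thm. 1.1] [cite: ColemanEdixhoven1998, Thm. 2.1]
[cite: Vatsal1999, §1 (1.6), Thm. (1.13)] [cite: GreenbergVatsal2000, §3 (17)–(19)] [cite: Ribet1984ICM, Thm. 4.1]
[cite: Skinner2016PacificMC, Thm. C (§1)] [cite: Mazur1978, Cor. 4.1] [cite: Kim2022StructureSelmer, Conj. 1.10 (PDF p. 8)] -/
theorem stub_nonAdditive_semistable_squarefree
    (hRk : ribet1990_levelLowering_gamma0_newform_at_three_squarefree)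
    (hCE : colemanEdixhoven1998_heckePolynomial_simpleRoots)
    (hV : vatsal1999_plusSymbol_congruence) (hGV : greenbergVatsal2000_plusSymbol_congruence)
    (hI : ribet1984_iharaLemma)
    (hSk : Skinner2016.thmC_padicValRat_bsd_rank_zero)
    (hmod : hasEntireLFunction_rat) (hGZK : rank_eq_analyticRank_of_analyticRank_le_one)
    (hM : mazur_not_dvd_maninConstant_of_odd)
    (hBCDT : exists_isNewformOf) (hLL' : diamond1995_refinedSerre) :
    ∀ (W₀ : WeierstrassCurve ℚ) [W₀.IsElliptic] [W₀.IsGloballyMinimal],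
      (∀ n : ℕ, W₀.HasSurjectiveModNGaloisRep (3 ^ n : ℕ)) → Finite W₀.sha →
      ∀ {N : ℕ} [NeZero N], N = W₀.conductorNorm ℤ →
      ∀ (D₀ : ModularParametrizationData W₀ N),
        (∀ z ∈ D₀.L.lattice, ∃ w ∈ periodLattice D₀.f, z = D₀.c * w) →
        (∀ (W₂ : WeierstrassCurve ℚ) [W₂.IsElliptic] (D₂ : ModularParametrizationData W₂ N),
          D₂.f = D₀.f → D₀.modularDegree ≤ D₂.modularDegree) →
        (∀ r : ℚ, ratPlusSymbol D₀.f r ≠ 0 → 0 ≤ padicValRat 3 (ratPlusSymbol D₀.f r)) →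
        kuriharaVanishingOrder W₀ 3 D₀.f = 0 →
        ¬ (haveI : Fact (Nat.Prime 3) := ⟨Nat.prime_three⟩; Addv W₀ 3) →
        Semistable W₀ →
        (W₀.HasGoodReductionAtPrime 3 → ¬ (3 : ℤ) ∣ W₀.frobeniusTrace 3) →
        padicValNat 3 W₀.tamagawaProduct ≤ 1 →
        ∀ {M₀ D q : ℕ} [NeZero M₀] [Fact q.Prime], M₀ * D * q = N →
        W₀.HasSplitMultiplicativeReductionAtPrime q → ¬ q ∣ M₀ * D → Squarefree (M₀ * D) →
        (3 : ℤ) ∣ padicValRat q W₀.Δ → (∀ r : ℕ, r.Prime → r ∣ D → (3 : ℤ) ∣ padicValRat r W₀.Δ) →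
        (∀ p : ℕ, p.Prime → p ∣ M₀ → p ≠ 3 → ¬ (3 : ℤ) ∣ padicValRat p W₀.Δ) →
        (3 ∣ M₀ → ¬ (3 : ℤ) ∣ padicValRat 3 W₀.Δ) →
        ∃ d : ℕ, kuriharaPartialDeepInfty W₀ 3 D₀.f = d ∧
          kuriharaPartial W₀ 3 D₀.f 0 ≤
            ((padicValNat 3 (Nat.card (AddCommGroup.primaryComponent W₀.sha 3)) + d : ℕ) : ℕ∞) := by
  intro W₀ _ _ htower hfin N _ hN D₀ hopt hdeg hint hord hnA hsst hordinary hv M₀ D q _ _ hMDq hsplit hqMD hMDsq hqΔ hDΔ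
    hpΔ h3Δ
  have hq : q.Prime := Fact.out
  have hsurj : W₀.HasSurjectiveModNGaloisRep 3 := by simpa using htower 1
  have hf := D₀.isNewformOf
  have hNsq : Squarefree N := by
    rw [← hMDq]
    exact (Nat.squarefree_mul ((Nat.Prime.coprime_iff_not_dvd hq).mpr hqMD).symm).mpr ⟨hMDsq, hq.prime.squarefree⟩
  -- the signs `a_p(f) = ±1` at the (multiplicative) primes of `D`
  have hsign : ∀ p : ℕ, p.Prime → p ∣ D → ∃ u : ℤ, u * u = 1 ∧ cuspCoeff D₀.f p = u := by
    intro p hp hpD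
    haveI : Fact p.Prime := ⟨hp⟩
    have hpN : p ∣ W₀.conductorNorm ℤ := by
      rw [← hN, ← hMDq]
      exact (hpD.mul_left M₀).mul_right q
    have hmult : W₀.HasMultiplicativeReductionAtPrime p :=
      (hsst p hp).resolve_left fun hgood ↦ not_dvd_conductorNorm_of_hasGoodReductionAtPrime W₀ hgood hpN
    by_cases hs : W₀.HasSplitMultiplicativeReductionAtPrime p
    · refine ⟨1, by norm_num, ?_⟩
      rw [hf.2 p, W₀.LFunction_apply_prime_of_hasSplitMultiplicativeReductionAtPrime p hs]
    · refine ⟨-1, by norm_num, ?_⟩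
      rw [hf.2 p, W₀.LFunction_apply_prime_of_hasMultiplicativeReductionAtPrime_of_not_split p hmult hs]
  -- the optimal-level newform from the general-form level-lowering fact BY NAME, at the removed set `D q`
  have hex : ∀ ι : PadicAlgCl 3 ≃+* ℂ, ∃ g : CuspForm (Gamma0 M₀) 2, IsNewform0 g ∧
      (∀ p : ℕ, p.Prime → ¬ p ∣ D * q → Valued.v (ι.symm (cuspCoeff D₀.f p - cuspCoeff g p)) < 1) ∧
      (∀ p : ℕ, p.Prime → p ∣ D * q → Valued.v (ι.symm (cuspCoeff g p - cuspCoeff D₀.f p * (p + 1))) < 1) := by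
    intro ι
    refine hRk W₀ hsurj (M₀ := M₀) (D := D * q) (by rw [← hMDq, mul_assoc]) hNsq hN (fun r hr hrDq ↦ ?_) hpΔ h3Δ D₀ ι
    rcases (Nat.Prime.dvd_mul hr).mp hrDq with h | h
    · exact hDΔ r hr h
    · rw [(Nat.prime_dvd_prime_iff_eq hr hq).mp h]; exact hqΔ
  exact stub_nonAdditive_semistable_squarefree_of_exists_levelLoweredNewform hCE hV hGV hI hSk hmod hGZK hM hBCDT hLL'
    W₀ htower hfin hN D₀ hopt hdeg hint hord hnA hsst hordinary hv hMDq hsplit hqMD hMDsq hsign hex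

end Summit.BirchSwinnertonDyer.BirchSwinnertonDyer.Theorems.KimAtThreeDeepLowerOffStratumLevelLoweringMultiStabRowsFinal

end
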